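import Literature.NumberTheory.LFunctions.RudnickSarnak
import Mathlib.MeasureTheory.Constructions.Pi
import Mathlib.MeasureTheory.Group.Measure
import Mathlib.MeasureTheory.Measure.Haar.Unique
import Mathlib.MeasureTheory.Integral.Bochner.Basic
import HarnessLib

/-!
# The hyperplane integral `∫ g(ξ) δ(∑ ξ_j) dξ` and its invariance under permutations

Rudnick–Sarnak (Duke Math. J. **81** (1996)) integrate throughout §§3–4 against the measure
`δ(ξ_1 + ⋯ + ξ_n) dξ` on the hyperplane `∑ ξ_j = 0` of `ℝⁿ` ((3.6), (4.11)–(4.14)); the tree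
writes this measure in the slice coordinates `η = (ξ_1, …, ξ_k)`, `ξ_0 = -∑ η_i` (`rsPhiTest`,
`n = k + 1`). This file records the coordinate-free content needed for the pull-backs
`ι_F^*` of (4.11)–(4.14): the hyperplane integral

* `hypInt g = ∫ g(-∑η, η) dη`

is invariant under permutations of the coordinates (`hypInt_comp_perm`) — the substitution
`η ↦ η̃` with `(-∑η̃, η̃) = (-∑η, η) ∘ β` is a coordinate permutation composed with one shear
`η_j ↦ -∑_i η_i` (for the transposition moving `0`), both of Jacobian `±1` — and consequently
`rsPhiTest` is equivariant: `rsPhiTest (Φ ∘ (· ∘ β)) x = rsPhiTest Φ (x ∘ β)`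
(`rsPhiTest_comp_perm`).

## Contents

* `hypShift β` (the substitution), `cons_hypShift`, `hypShift_mul`, `hypShiftMEquiv`,
  `measurePreserving_hypShift`.
* `hypInt`, `hypInt_comp_perm`; `rsPhiTest_eq_hypInt`, `rsPhiTest_comp_perm`.

## References

* Z. Rudnick, P. Sarnak, Duke Math. J. 81 (1996), (3.6), (4.11)–(4.14).
-/

noncomputable section

open MeasureTheory Finset Equiv Complex
open scoped Real

namespace Literature.NumberTheory.LFunctions

namespace RudnickSarnak

variable {k : ℕ}

/-! ## The substitution attached to a permutation -/

/-- The point `(-∑ η, η)` of the hyperplane `∑ ξ_j = 0` with slice coordinates `η`. [folklore] -/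
abbrev hypPoint (η : Fin k → ℝ) : Fin (k + 1) → ℝ := Fin.cons (-∑ i, η i) η

/-- The coordinates of a hyperplane point sum to zero. [folklore] -/
theorem sum_hypPoint (η : Fin k → ℝ) : ∑ j, hypPoint η j = 0 := by
  rw [Fin.sum_univ_succ]
  simp [hypPoint]

/-- The substitution `η ↦ η̃` with `(-∑ η̃, η̃) = (-∑ η, η) ∘ β`: the slice coordinates of the
permuted hyperplane point. [folklore] -/
def hypShift (β : Perm (Fin (k + 1))) (η : Fin k → ℝ) : Fin k → ℝ := fun i ↦ hypPoint η (β i.succ)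

/-- `(-∑ η̃, η̃) = (-∑ η, η) ∘ β`. [folklore] -/
theorem hypPoint_hypShift (β : Perm (Fin (k + 1))) (η : Fin k → ℝ) :
    hypPoint (hypShift β η) = hypPoint η ∘ β := by
  funext j
  refine Fin.cases ?_ (fun i ↦ ?_) j
  · -- the `0`-coordinate: `-∑ η̃ = (hypPoint η) (β 0)` since all coordinates sum to zero
    simp only [hypPoint, Fin.cons_zero, Function.comp_apply]
    have h := sum_hypPoint η
    rw [← Equiv.sum_comp β (hypPoint η), Fin.sum_univ_succ] at h
    simp only [hypShift, hypPoint] at h ⊢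
    linarith
  · simp [hypShift, hypPoint]

/-- [folklore] -/
theorem hypShift_one (η : Fin k → ℝ) : hypShift (1 : Perm (Fin (k + 1))) η = η := by
  funext i
  simp [hypShift, hypPoint]

/-- The substitution is an anti-homomorphism: `hypShift (β * γ) = hypShift γ ∘ hypShift β`.
[folklore] -/
theorem hypShift_mul (β γ : Perm (Fin (k + 1))) (η : Fin k → ℝ) :
    hypShift (β * γ) η = hypShift γ (hypShift β η) := by
  funext i
  simp only [hypShift, Perm.mul_apply]
  rw [hypPoint_hypShift β η]
  rfl

/-- The substitution is continuous. [folklore] -/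
theorem continuous_hypShift (β : Perm (Fin (k + 1))) : Continuous (hypShift β) := by
  refine continuous_pi fun i ↦ ?_
  simp only [hypShift]
  have hc : Continuous fun η : Fin k → ℝ ↦ hypPoint η := by
    refine continuous_pi fun j ↦ ?_
    refine Fin.cases ?_ (fun i ↦ ?_) j
    · simp only [hypPoint, Fin.cons_zero]
      exact (continuous_finsetSum _ fun i _ ↦ continuous_apply i).neg
    · simp only [hypPoint, Fin.cons_succ]
      exact continuous_apply i
  exact (continuous_apply (β i.succ)).comp hc

/-- The substitution as a measurable equivalence (inverse: the substitution of `β⁻¹`).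
[folklore] -/
def hypShiftMEquiv (β : Perm (Fin (k + 1))) : (Fin k → ℝ) ≃ᵐ (Fin k → ℝ) where
  toFun := hypShift β
  invFun := hypShift β⁻¹
  left_inv η := by
    rw [← hypShift_mul, mul_inv_cancel, hypShift_one]
  right_inv η := by
    rw [← hypShift_mul, inv_mul_cancel, hypShift_one]
  measurable_toFun := (continuous_hypShift β).measurable
  measurable_invFun := (continuous_hypShift β⁻¹).measurable

/-- [folklore] -/
theorem hypShiftMEquiv_apply (β : Perm (Fin (k + 1))) (η : Fin k → ℝ) :
    hypShiftMEquiv β η = hypShift β η := rfl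

/-! ## Measure preservation -/

/-- Composition with a permutation of the coordinates preserves Lebesgue measure on `ℝᵏ`.
[folklore] -/
theorem measurePreserving_comp_perm (γ : Perm (Fin k)) :
    MeasurePreserving (fun η : Fin k → ℝ ↦ η ∘ ⇑γ) (volume : Measure (Fin k → ℝ)) volume := by
  have hmeas : Measurable (fun η : Fin k → ℝ ↦ η ∘ ⇑γ) :=
    measurable_pi_iff.2 fun i ↦ measurable_pi_apply (γ i)
  refine ⟨hmeas, ?_⟩
  symm
  refine Measure.pi_eq fun s hs ↦ ?_
  rw [Measure.map_apply hmeas (MeasurableSet.univ_pi hs)]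
  have : (fun η : Fin k → ℝ ↦ η ∘ ⇑γ) ⁻¹' Set.pi Set.univ s = Set.pi Set.univ (fun i ↦ s (γ⁻¹ i)) := by
    ext η
    simp only [Set.mem_preimage, Set.mem_univ_pi, Function.comp_apply]
    constructor
    · intro h i
      simpa using h (γ⁻¹ i)
    · intro h i
      simpa using h (γ i)
  rw [this, volume_pi_pi]
  exact Equiv.prod_comp γ⁻¹ (fun i ↦ volume (s i))

/-- For `β` fixing `0`, the substitution is a coordinate permutation. [folklore] -/
theorem measurePreserving_hypShift_of_apply_zero {β : Perm (Fin (k + 1))} (hβ : β 0 = 0) :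
    MeasurePreserving (hypShift β) (volume : Measure (Fin k → ℝ)) volume := by
  -- the induced permutation of `Fin k`
  have hne : ∀ i : Fin k, β i.succ ≠ 0 := fun i h ↦ Fin.succ_ne_zero i (β.injective (h.trans hβ.symm))
  set γ : Fin k → Fin k := fun i ↦ (β i.succ).pred (hne i) with hγ
  have hγinj : Function.Injective γ := by
    intro i j h
    have : β i.succ = β j.succ := by
      rw [← Fin.succ_pred (β i.succ) (hne i), ← Fin.succ_pred (β j.succ) (hne j)]
      exact congrArg Fin.succ h
    exact Fin.succ_injective _ (β.injective this)
  set γe : Perm (Fin k) := Equiv.ofBijective γ ⟨hγinj, Finite.injective_iff_surjective.1 hγinj⟩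
    with hγe
  have heq : hypShift β = fun η : Fin k → ℝ ↦ η ∘ γe := by
    funext η i
    simp only [hypShift, hypPoint, Function.comp_apply, hγe, Equiv.ofBijective_apply, hγ]
    conv_lhs => rw [← Fin.succ_pred (β i.succ) (hne i)]
    rw [Fin.cons_succ]
  rw [heq]
  exact measurePreserving_comp_perm γe

/-- The shear `η_j ↦ -∑_i η_i` (other coordinates fixed) preserves Lebesgue measure.
[folklore] -/
theorem measurePreserving_update_neg_sum (j : Fin k) :
    MeasurePreserving (fun η : Fin k → ℝ ↦ Function.update η j (-∑ i, η i))
      (volume : Measure (Fin k → ℝ)) volume := by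
  obtain ⟨k', rfl⟩ : ∃ k', k = k' + 1 := ⟨k - 1, by have := j.pos; omega⟩
  -- split off the `j`-th coordinate
  set e := MeasurableEquiv.piFinSuccAbove (fun _ : Fin (k' + 1) ↦ ℝ) j with he
  have hev : MeasurePreserving e volume (volume.prod volume) :=
    volume_preserving_piFinSuccAbove (fun _ : Fin (k' + 1) ↦ ℝ) j
  -- the map in the split coordinates: `(x, y) ↦ (-x - ∑ y, y)`
  set S : ℝ × (Fin k' → ℝ) → ℝ × (Fin k' → ℝ) := fun p ↦ (-p.1 - ∑ i, p.2 i, p.2) with hS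
  have hS' : MeasurePreserving S (volume.prod volume) (volume.prod volume) := by
    have hgm : Measurable (Function.uncurry fun (y : Fin k' → ℝ) (x : ℝ) ↦ -x - ∑ i, y i) :=
      ((measurable_snd.neg).sub ((Finset.measurable_sum _ fun i _ ↦
          measurable_pi_apply i).comp measurable_fst))
    have hmap : ∀ᵐ y : Fin k' → ℝ ∂volume,
        Measure.map ((fun (y : Fin k' → ℝ) (x : ℝ) ↦ -x - ∑ i, y i) y) volume = volume := by
      refine Filter.Eventually.of_forall fun y ↦ ?_
      change Measure.map (fun x : ℝ ↦ -x - ∑ i, y i) volume = volume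
      have : (fun x : ℝ ↦ -x - ∑ i, y i) = (fun x ↦ x - ∑ i, y i) ∘ Neg.neg := rfl
      rw [this]
      exact ((measurePreserving_sub_right volume _).comp
        (Measure.measurePreserving_neg volume)).map_eq
    have h1 : MeasurePreserving (fun p : (Fin k' → ℝ) × ℝ ↦ (id p.1,
        (fun (y : Fin k' → ℝ) (x : ℝ) ↦ -x - ∑ i, y i) p.1 p.2))
        ((volume : Measure (Fin k' → ℝ)).prod volume) (volume.prod volume) :=
      MeasurePreserving.skew_product (MeasurePreserving.id _) hgm hmap
    have hswap := (MeasureTheory.Measure.measurePreserving_swap (μ := (volume : Measure ℝ))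
      (ν := (volume : Measure (Fin k' → ℝ))))
    have hswap' := (MeasureTheory.Measure.measurePreserving_swap (μ := (volume : Measure (Fin k' → ℝ)))
      (ν := (volume : Measure ℝ)))
    have : S = Prod.swap ∘ (fun p : (Fin k' → ℝ) × ℝ ↦ (id p.1,
        (fun (y : Fin k' → ℝ) (x : ℝ) ↦ -x - ∑ i, y i) p.1 p.2)) ∘ Prod.swap := by
      funext p
      rfl
    rw [this]
    exact hswap'.comp (h1.comp hswap)
  -- the shear is `e⁻¹ ∘ S ∘ e`
  have hconj : (fun η : Fin (k' + 1) → ℝ ↦ Function.update η j (-∑ i, η i)) = e.symm ∘ S ∘ e := by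
    funext η
    apply funext
    intro i
    simp only [Function.comp_apply, hS, he, MeasurableEquiv.piFinSuccAbove_apply,
      MeasurableEquiv.piFinSuccAbove_symm_apply, Fin.insertNthEquiv_apply,
      Fin.insertNthEquiv_symm_apply, Fin.removeNth]
    rcases eq_or_ne i j with rfl | hij
    · rw [Function.update_self, Fin.insertNth_apply_same, Fin.sum_univ_succAbove _ i]
      ring
    · obtain ⟨i', rfl⟩ := Fin.exists_succAbove_eq hij
      rw [Function.update_of_ne hij, Fin.insertNth_apply_succAbove]
      rfl
  rw [hconj]
  exact (hev.symm e).comp (hS'.comp hev)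

/-- For a transposition `(0 j+1)`, the substitution is the shear `η_j ↦ -∑ η`. [folklore] -/
theorem hypShift_swap (j : Fin k) (η : Fin k → ℝ) :
    hypShift (Equiv.swap 0 j.succ) η = Function.update η j (-∑ i, η i) := by
  funext i
  unfold hypShift hypPoint
  by_cases h : i = j
  · subst h
    rw [Equiv.swap_apply_right, Fin.cons_zero, Function.update_self]
  · rw [Equiv.swap_apply_of_ne_of_ne (Fin.succ_ne_zero i) (fun h' ↦ h (Fin.succ_injective _ h')),
      Fin.cons_succ, Function.update_of_ne h]

/-- **The substitution preserves Lebesgue measure** (Jacobian `±1`). [folklore] -/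
theorem measurePreserving_hypShift (β : Perm (Fin (k + 1))) :
    MeasurePreserving (hypShift β) (volume : Measure (Fin k → ℝ)) volume := by
  -- `β = s * β₁` with `s = (0 β0)` and `β₁ 0 = 0`
  set s : Perm (Fin (k + 1)) := Equiv.swap 0 (β 0) with hs
  set β₁ : Perm (Fin (k + 1)) := s * β with hβ₁
  have hβ₁0 : β₁ 0 = 0 := by simp [hβ₁, hs, Perm.mul_apply]
  have hβ : β = s * β₁ := by
    rw [hβ₁, ← mul_assoc, hs, Equiv.swap_mul_self, one_mul]
  have hs' : MeasurePreserving (hypShift s) (volume : Measure (Fin k → ℝ)) volume := by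
    by_cases h0 : β 0 = 0
    · have : s = 1 := by rw [hs, h0, Equiv.swap_self]; rfl
      rw [this, show (hypShift (1 : Perm (Fin (k + 1))) : (Fin k → ℝ) → Fin k → ℝ) = id from
        funext hypShift_one]
      exact MeasurePreserving.id _
    · set j := (β 0).pred h0 with hj
      have : s = Equiv.swap 0 j.succ := by rw [hs, hj, Fin.succ_pred]
      rw [this, show hypShift (Equiv.swap 0 j.succ) = fun η : Fin k → ℝ ↦
        Function.update η j (-∑ i, η i) from funext (hypShift_swap j)]
      exact measurePreserving_update_neg_sum j
  have h := (measurePreserving_hypShift_of_apply_zero hβ₁0).comp hs'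
  have heq : hypShift β = hypShift β₁ ∘ hypShift s := by
    funext η
    rw [hβ, hypShift_mul]
    rfl
  rw [heq]
  exact h

/-! ## The hyperplane integral -/

/-- The hyperplane integral `∫_{ℝⁿ} g(ξ) δ(ξ_1 + ⋯ + ξ_n) dξ := ∫_{ℝᵏ} g(-∑η, η) dη`
(`n = k + 1`; the slice coordinates of `rsPhiTest`). [cite: RudnickSarnak1996, (3.6)] -/
def hypInt {E : Type*} [NormedAddCommGroup E] [NormedSpace ℝ E] (g : (Fin (k + 1) → ℝ) → E) : E :=
  ∫ η : Fin k → ℝ, g (hypPoint η)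

/-- **Permutation invariance of the hyperplane integral**: `∫ g(ξ ∘ β) δ(∑ξ) dξ = ∫ g(ξ) δ(∑ξ) dξ`
(no integrability needed: the substitution is a measure-preserving bijection).
[cite: RudnickSarnak1996, (4.11)–(4.14)] -/
theorem hypInt_comp_perm {E : Type*} [NormedAddCommGroup E] [NormedSpace ℝ E]
    (β : Perm (Fin (k + 1))) (g : (Fin (k + 1) → ℝ) → E) :
    hypInt (fun ξ ↦ g (ξ ∘ β)) = hypInt g := by
  unfold hypInt
  have h : (fun η : Fin k → ℝ ↦ g (hypPoint η ∘ β)) =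
      (fun η' : Fin k → ℝ ↦ g (hypPoint η')) ∘ ⇑(hypShiftMEquiv β) := by
    funext η
    simp only [Function.comp_apply, hypShiftMEquiv_apply, hypPoint_hypShift]
  rw [h]
  exact (measurePreserving_hypShift β).integral_comp' (f := hypShiftMEquiv β)
    (fun η' : Fin k → ℝ ↦ g (hypPoint η'))

/-- `rsPhiTest` as a hyperplane integral: `f_Φ(x) = ∫ Φ(ξ) e(-x·ξ) δ(∑ξ) dξ`
(`∑_i (x_{i+1} - x_0) η_i = ∑_j x_j ξ_j` on the hyperplane). [cite: RudnickSarnak1996, (3.6)] -/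
theorem rsPhiTest_eq_hypInt (Φ : (Fin (k + 1) → ℝ) → ℂ) (x : Fin (k + 1) → ℝ) :
    rsPhiTest Φ x = hypInt fun ξ ↦ Φ ξ * Complex.exp (-(2 * π * I * ∑ j, (x j * ξ j : ℝ))) := by
  unfold rsPhiTest hypInt
  congr 1
  funext η
  have hsum : ∑ i : Fin k, (x i.succ - x 0) * η i = ∑ j, x j * hypPoint η j := by
    rw [Fin.sum_univ_succ]
    simp only [hypPoint, Fin.cons_zero, Fin.cons_succ]
    rw [mul_neg, Finset.mul_sum, ← Finset.sum_neg_distrib, ← Finset.sum_add_distrib]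
    exact Finset.sum_congr rfl fun i _ ↦ by ring
  rw [hsum]

/-- **Equivariance of `f_Φ` under permutations of the coordinates**:
`f_{Φ ∘ (· ∘ β)}(x) = f_Φ(x ∘ β)`. [cite: RudnickSarnak1996, (3.6)] -/
theorem rsPhiTest_comp_perm (Φ : (Fin (k + 1) → ℝ) → ℂ) (β : Perm (Fin (k + 1))) (x : Fin (k + 1) → ℝ) :
    rsPhiTest (fun ξ ↦ Φ (ξ ∘ β)) x = rsPhiTest Φ (x ∘ β) := by
  rw [rsPhiTest_eq_hypInt, rsPhiTest_eq_hypInt,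
    ← hypInt_comp_perm β (fun ξ ↦ Φ ξ * Complex.exp (-(2 * π * I * ∑ j, ((x ∘ β) j * ξ j : ℝ))))]
  congr 1
  funext ξ
  simp only [Function.comp_apply]
  rw [(Equiv.sum_comp β (fun j ↦ x j * ξ j))]

end RudnickSarnak

end Literature.NumberTheory.LFunctions

end
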